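import Summits.BirchSwinnertonDyer.BirchSwinnertonDyer.Theorems.ShaPrimaryTransferFiniteShaComponentTransferZywinaEqualityDoorKato
import HarnessLib

/-!
# BirchSwinnertonDyer / ShaPrimaryTransfer — crux `FiniteShaComponentTransfer` (stmt-BirchSwinnertonDyer-22356):
# the `5`-adic equality door typed on an INFINITE class of rank-2 curves

Companion of `…ZywinaEqualityDoor` (p762237), `…Primes` (p762511), `…Kato` (p762672).  Those files type the door
member-by-member on Zywina's family `E_{m,n}` (admissible `(m, n)`, `7 ∣ n`).  Here the members are COUNTED: modulo
the infinitude of the admissible pairs with `7 ∣ n` — hypothesis `hInf`, which is Zywina 2025 §4 run in the residue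
class `7 ∣ n` (Tao–Ziegler 2008 Thm 1.3 with the pattern `(x, x + 16(84y)², x + 25(84y)²)`; in the tree it is the
`L = 1, d = 7` instance of `Zywina2025.infinite_setOf_zywinaAdmissible_modEq_dvd` of
`Literature/NumberTheory/EllipticCurves/Zywina2025AdmissibleClasses.lean`, modulo the named fact
`TaoZiegler2008_polynomialProgressions`; that module is accepted but not yet BUILT on the hub, so the one-line discharge
`hInf := (infinite_setOf_zywinaAdmissible_modEq_dvd hTZ one_pos (by norm_num) rfl (Nat.coprime_one_right _)).mono …`
is left to the next seat) — and pairwise distinct `j`-invariants (`Zywina2025.eq_of_j_eq`, tree theorem):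

* `infinite_setOf_j_rankTwo_goodOrdinary_irreducible_five` — UNCONDITIONAL mod `hInf`: infinitely many `j(E)`, `E/ℚ`
  with `rank E(ℚ) = 2`, `5` good ordinary, `E[5]` irreducible, `Ш(E)[2^∞] = 0` — i.e. infinitely many rank-2 curves
  inside the hypotheses of the `5`-adic Iwasawa main conjecture / Perrin-Riou–Schneider / Kato.
* `infinite_setOf_j_rankTwo_asymmetricDoor_five` — mod `hInf` and the prints `h85` (PRS 85), `hMC` (BCS): infinitely
  many `j(E)` with all of the above AND, for the newform `f` of `E` and Kato's divisibility at `5`: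
  `ord_{T=0} L_5(E,T) = 2 ⟹ (Reg_5(E) ≠ 0 ∧ Ш(E)[5^∞]` finite`)` and `(Reg_5(E) ≠ 0 → Ш(E)[5^∞]` finite `→ ord_{T=0} L_5(E,T) = 2)`.
* `infinite_setOf_j_rankTwo_transferInstance_iff` — mod `hInf`, `h85`, `hMC`: infinitely many `j(E)` on which T's
  instance `(E, 2, 5)` is EQUIVALENT, given `Reg_5(E) ≠ 0`, to `ord_{T=0} L_5(E,T) = 2`.

PARTITION: r_an ≥ 2 side; S0 not touched (B1 honesty: no analytic rank is bounded; `hInf`, `h85`, `hMC`, Kato are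
hypotheses BY NAME).  References: D. Zywina, arXiv:2502.01957 Thm. 1.1, §4; T. Tao, T. Ziegler, Acta Math. 201 (2008)
Thm. 1.3; K. Kato, Astérisque 295 (2004) Thm. 17.4; J. Balakrishnan, J. S. Müller, W. Stein, Math. Comp. 85 (2016)
Thm. 1.7; A. Burungale, F. Castella, C. Skinner (2025) Thm. 1.1.2.
-/

-- D-0017: single-problem summit, so `Summit.BirchSwinnertonDyer.BirchSwinnertonDyer.…` repeats a namespace BY DESIGN.
set_option linter.dupNamespace false

noncomputable section

namespace Summit.BirchSwinnertonDyer.BirchSwinnertonDyer.Theorems.ShaPrimaryTransferZywinaEqualityDoorInfinite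

open scoped Classical MatrixGroups ModularForm
open CongruenceSubgroup
open Literature.NumberTheory.EllipticCurves Literature.NumberTheory.EllipticCurves.Zywina2025
  Literature.NumberTheory.EllipticCurves.ModularForms
open WeierstrassCurve
open Summit.BirchSwinnertonDyer.BirchSwinnertonDyer.Rank1Residual
open Summit.BirchSwinnertonDyer.Rank1Residual.Additive
open Summit.BirchSwinnertonDyer.BirchSwinnertonDyer.Theses.ShaPrimaryTransfer (FiniteShaComponentTransfer)
open Summit.BirchSwinnertonDyer.BirchSwinnertonDyer.Theorems.ShaPrimaryTransferGoodOrdinaryFive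
open Summit.BirchSwinnertonDyer.BirchSwinnertonDyer.Theorems.ShaPrimaryTransferZywinaEqualityDoor
open Summit.BirchSwinnertonDyer.BirchSwinnertonDyer.Theorems.ShaPrimaryTransferZywinaEqualityDoorKato

/-- The admissible pairs with `7 ∣ n` (the residue class on which the `ℓ = 7` Frobenius certificate gives `E_{m,n}[5]`
irreducible). [cite: Zywina2025, §4 (proof of Thm 1.1, first paragraph)] -/
theorem mem_setOf_admissible_seven {mn : ℕ × ℕ} :
    mn ∈ {mn : ℕ × ℕ | ZywinaAdmissible mn.1 mn.2 ∧ 7 ∣ mn.2} ↔ ZywinaAdmissible mn.1 mn.2 ∧ 7 ∣ mn.2 :=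
  Iff.rfl

/-- `(m, n) ↦ j(E_{m,n})` (junk value `0` off the admissible set) is injective on the admissible pairs with `7 ∣ n`
(Zywina, Lemma 4.1: `j(E_{m,n})` determines `(m, n)`; tree theorem `eq_of_j_eq`). [cite: Zywina2025, Lemma 4.1] -/
theorem injOn_j_admissible_seven :
    Set.InjOn (fun q : ℕ × ℕ ↦ if hq : ZywinaAdmissible q.1 q.2 then
        @WeierstrassCurve.j _ _ (zywinaCurve q.1 q.2) (isElliptic_zywinaCurve hq) else 0)
      {mn : ℕ × ℕ | ZywinaAdmissible mn.1 mn.2 ∧ 7 ∣ mn.2} := by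
  rintro ⟨m, n⟩ h₁ ⟨m', n'⟩ h₂ he
  have h₁' : ZywinaAdmissible m n := h₁.1
  have h₂' : ZywinaAdmissible m' n' := h₂.1
  simp only [dif_pos h₁', dif_pos h₂'] at he
  obtain ⟨rfl, rfl⟩ := eq_of_j_eq h₁' h₂' he
  rfl

/-- **Infinitely many rank-2 curves inside the `5`-adic Iwasawa hypotheses** (UNCONDITIONAL modulo `hInf` = Zywina §4 /
Tao–Ziegler in the class `7 ∣ n`): infinitely many `j(E)` with `rank E(ℚ) = 2`, `5` of good ordinary reduction, `E[5]`
irreducible and `corank Ш(E)[2^∞] = 0`. [cite: Zywina2025, Thm 1.1 and Thm 1.2] [cite: Mazur1978, §6 Prop. 6.3 (1)] -/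
theorem infinite_setOf_j_rankTwo_goodOrdinary_irreducible_five [Fact (Nat.Prime 5)] [Fact (Nat.Prime 2)]
    (hInf : {mn : ℕ × ℕ | ZywinaAdmissible mn.1 mn.2 ∧ 7 ∣ mn.2}.Infinite) :
    {j : ℚ | ∃ (W : WeierstrassCurve ℚ) (hW : W.IsElliptic) (_ : W.IsGloballyMinimal),
      @WeierstrassCurve.j _ _ W hW = j ∧ W.mordellWeilRank = 2 ∧ W.HasGoodReductionAtPrime 5 ∧
      ¬ ((5 : ℕ) : ℤ) ∣ W.frobeniusTrace 5 ∧ W.HasIrreducibleModPGaloisRep 5 ∧ W.shaCorank 2 = 0}.Infinite := by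
  refine Set.infinite_of_injOn_mapsTo injOn_j_admissible_seven ?_ hInf
  rintro ⟨m, n⟩ ⟨hq, h7⟩
  haveI := isElliptic_zywinaCurve hq
  haveI := isGloballyMinimal_zywinaCurve hq
  obtain ⟨hgood, hord⟩ := goodOrdinary_five_zywinaCurve hq
  exact ⟨zywinaCurve m n, isElliptic_zywinaCurve hq, isGloballyMinimal_zywinaCurve hq, by simp only [dif_pos hq],
    mordellWeilRank_zywinaCurve hq, hgood, hord, hasIrreducibleModPGaloisRep_five_zywinaCurve hq h7,
    shaCorank_two_zywinaCurve hq⟩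

/-- **THE `5`-ADIC EQUALITY DOOR ON AN INFINITE CLASS OF RANK-2 CURVES** (mod `hInf` and the prints `h85`, `hMC`):
infinitely many `j(E)`, `E/ℚ` of rank `2` with `5` good ordinary and `E[5]` irreducible, such that for the newform `f`
of `E`, granting Kato's divisibility at `5`: `ord_{T=0} L_5(E,T) = 2 ⟹ Reg_5(E) ≠ 0 ∧ Ш(E)[5^∞]` finite (PRS 85 +
Kato), and `Reg_5(E) ≠ 0 → Ш(E)[5^∞]` finite `→ ord_{T=0} L_5(E,T) = 2` (PRS 85 + BCS). CONDITIONAL on `hInf`, `h85`,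
`hMC` (and per curve on `kato_divisibility_allPrimes`). [cite: Zywina2025, Thm 1.1 and Thm 1.2]
[cite: Kato2004Asterisque, Thm. 17.4 (1)(2) (p. 273)] [cite: BurungaleCastellaSkinner2025, Thm. 1.1.2 (a)]
[cite: BalakrishnanMullerStein2015, Thm. 1.7] -/
theorem infinite_setOf_j_rankTwo_asymmetricDoor_five [Fact (Nat.Prime 5)]
    (hInf : {mn : ℕ × ℕ | ZywinaAdmissible mn.1 mn.2 ∧ 7 ∣ mn.2}.Infinite)
    (h85 : Schneider1985_order_charGenerator) (hMC : burungale_castella_skinner_charIdeal_eq_padicLFunction) :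
    {j : ℚ | ∃ (W : WeierstrassCurve ℚ) (hW : W.IsElliptic) (_ : W.IsGloballyMinimal),
      @WeierstrassCurve.j _ _ W hW = j ∧ W.mordellWeilRank = 2 ∧ W.HasGoodReductionAtPrime 5 ∧
      ¬ ((5 : ℕ) : ℤ) ∣ W.frobeniusTrace 5 ∧ W.HasIrreducibleModPGaloisRep 5 ∧
      ∀ {N : ℕ} [NeZero N] (f : CuspForm (Gamma0 N) 2), IsNewformOf W f →
        kato_divisibility_allPrimes W 5 (f := f) →
        (((padicLFunction f (unitRoot W 5 : ℚ_[5])).order = 2 →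
            (∀ Dh : PAdicHeightData W 5, Dh.IsCanonical → SchneiderConjecture Dh) ∧
              Finite (AddCommGroup.primaryComponent W.sha 5)) ∧
          ((∀ Dh : PAdicHeightData W 5, Dh.IsCanonical → SchneiderConjecture Dh) →
            Finite (AddCommGroup.primaryComponent W.sha 5) →
              (padicLFunction f (unitRoot W 5 : ℚ_[5])).order = 2))}.Infinite := by
  refine Set.infinite_of_injOn_mapsTo injOn_j_admissible_seven ?_ hInf
  rintro ⟨m, n⟩ ⟨hq, h7⟩
  haveI := isElliptic_zywinaCurve hq
  haveI := isGloballyMinimal_zywinaCurve hq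
  obtain ⟨hgood, hord⟩ := goodOrdinary_five_zywinaCurve hq
  exact ⟨zywinaCurve m n, isElliptic_zywinaCurve hq, isGloballyMinimal_zywinaCurve hq, by simp only [dif_pos hq],
    mordellWeilRank_zywinaCurve hq, hgood, hord, hasIrreducibleModPGaloisRep_five_zywinaCurve hq h7,
    fun f hf hkato ↦ door_five_zywinaCurve_asymmetric h85 hMC hq h7 hf hkato⟩

/-- **T on an infinite class**: mod `hInf`, `h85`, `hMC`, infinitely many `j(E)` of rank-2 curves (5 good ordinary,
`E[5]` irreducible) on which, given `Reg_5(E) ≠ 0`, T's instance `(E, 2, 5)` — `t_2(E) = 0 → t_5(E) = 0` — is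
EQUIVALENT to `ord_{T=0} L_5(E,T) = 2`: each such curve is a two-sided test of the crux against `5`-adic analytic data.
CONDITIONAL on `hInf`, `h85`, `hMC`. [cite: Zywina2025, Thm 1.1 and Thm 1.2] [cite: BalakrishnanMullerStein2015, Thm. 1.7]
[cite: BurungaleCastellaSkinner2025, Thm. 1.1.2 (a)] -/
theorem infinite_setOf_j_rankTwo_transferInstance_iff [Fact (Nat.Prime 5)] [Fact (Nat.Prime 2)]
    (hInf : {mn : ℕ × ℕ | ZywinaAdmissible mn.1 mn.2 ∧ 7 ∣ mn.2}.Infinite)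
    (h85 : Schneider1985_order_charGenerator) (hMC : burungale_castella_skinner_charIdeal_eq_padicLFunction) :
    {j : ℚ | ∃ (W : WeierstrassCurve ℚ) (hW : W.IsElliptic) (_ : W.IsGloballyMinimal),
      @WeierstrassCurve.j _ _ W hW = j ∧ W.mordellWeilRank = 2 ∧ W.HasGoodReductionAtPrime 5 ∧
      ¬ ((5 : ℕ) : ℤ) ∣ W.frobeniusTrace 5 ∧ W.HasIrreducibleModPGaloisRep 5 ∧
      ∀ {N : ℕ} [NeZero N] (f : CuspForm (Gamma0 N) 2), IsNewformOf W f →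
        (∀ Dh : PAdicHeightData W 5, Dh.IsCanonical → SchneiderConjecture Dh) →
        ((W.shaCorank 2 = 0 → W.shaCorank 5 = 0) ↔
          (padicLFunction f (unitRoot W 5 : ℚ_[5])).order = 2)}.Infinite := by
  refine Set.infinite_of_injOn_mapsTo injOn_j_admissible_seven ?_ hInf
  rintro ⟨m, n⟩ ⟨hq, h7⟩
  haveI := isElliptic_zywinaCurve hq
  haveI := isGloballyMinimal_zywinaCurve hq
  obtain ⟨hgood, hord⟩ := goodOrdinary_five_zywinaCurve hq
  exact ⟨zywinaCurve m n, isElliptic_zywinaCurve hq, isGloballyMinimal_zywinaCurve hq, by simp only [dif_pos hq],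
    mordellWeilRank_zywinaCurve hq, hgood, hord, hasIrreducibleModPGaloisRep_five_zywinaCurve hq h7,
    fun f hf hReg ↦ transfer_instance_iff_order_eq_two h85 hMC hq h7 hReg hf⟩

end Summit.BirchSwinnertonDyer.BirchSwinnertonDyer.Theorems.ShaPrimaryTransferZywinaEqualityDoorInfinite

end
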